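import Mathlib
import Literature.Computability.AlgebraicComplexity.LRPencilOfMatrix
import Literature.Computability.AlgebraicComplexity.LandsbergRessayreNormalForm
import Literature.Computability.AlgebraicComplexity.DetReprEquivalent
import Literature.Computability.AlgebraicComplexity.VonZurGathenSingPermHeight
import Literature.Computability.AlgebraicComplexity.PencilFamily
import Literature.Computability.AlgebraicComplexity.PermanentIrreducible
import Summits.ValiantsHypothesis.ValiantsHypothesis.Theorems.FreeSubtorusOrbitDimensionBoundStubGradedElimination
import Summits.ValiantsHypothesis.ValiantsHypothesis.Theorems.FreeSubtorusOrbitDimensionBoundStubPartialPermDiag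
import Summits.ValiantsHypothesis.ValiantsHypothesis.Theorems.RigidityForcesSymmetryRankRigidMinimalReprPathExpansion

/-!
# `OrbitDimensionBound` (stmt-ValiantsHypothesis-16133), rung line `sign_covering` — stub `stub_signCount`,
# part A: group-graded normal form and weighted potentials along `bᵀ Dᵏ`

Toolkit for `Theorems/FreeSubtorusOrbitDimensionBoundStubSignCount.lean` (the sign-graded covering count, stub 4 of
`Cruxes/OrbitDimensionBound/Lines/sign_covering.lean`).  The grading group is an arbitrary additive commutative
group `G` (for the stub: `𝔽₂^{[n] ⊔ [n]} ⧸ S_Λ^⊥`); rows carry grades `rβ`, columns `rα`, the variable `x_p` the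
grade `ω_p`; an affine matrix is GRADED when a constant sits at `(i, j)` only if `rβ i = rα j` and `x_p` only if
`rβ i = rα j + ω_p`.

* `classGraded_normalForm` — a graded affine matrix `B` of size `m` with `det B = c · per_n` (`c ≠ 0`, `n ≥ 3`)
  is graded-gauge-equivalent to a graded `B'` with `det B' = c' · per_n` (`c' ≠ 0`) whose constant part IS the
  Landsberg–Ressayre normal form `Λ_{i₀}` (`lamMatrix`).  Same proof as the tree's degree-graded `gradedNormalForm`
  (`Theorems/FreeSubtorusOrbitDimensionBoundStrengthFour.lean`): von zur Gathen regularity `rank B(0) = m − 1`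
  (after rescaling one row), `stub_gradedElimination` with the grades ENCODED injectively in `ℤ` (only equality of
  grades is used), `stub_partialPermDiag`, row/column permutations.
* `isWeightedHomogeneous_vecMul_pow` — potentials along an ABP: `b_j` weighted-homogeneous of weight `θ − a_j` and
  `D_{jl}` of weight `a_j − a_l` make `(bᵀ Dᵏ)_l` weighted-homogeneous of weight `θ − a_l`;
  `isHomogeneous_vecMul_pow` — and homogeneous of degree `k + 1` for linear `b`, `D`.
* `homogeneousComponent_one_eq_sum`, `isWeightedHomogeneous_homogeneousComponent_one` — the linear part of a
  polynomial is `Σ_p coeff_{e_p} · X_p`, hence weighted-homogeneous of weight `g` when every variable occurring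
  linearly has weight `g`.
* `mem_span_of_forall_dotProduct_eq_zero` (double annihilator over `𝔽₂`: `(U^⊥)^⊥ ≤ U` for the dot product),
  `card_le_natCard_of_mkQ_eq` (injectively labelled vectors in one coset of `U` number `≤ |U|`),
  `natCard_span_le_two_pow` (`|span of r vectors| ≤ 2^r`).
* `exists_eq_sum_single_of_le_permMonomial`, `weight_sum_single` — a divisor of the permutation monomial
  `μ_ρ = Σ_i e_{(ρ i, i)}` is `Σ_{i ∈ I} e_{(ρ i, i)}` for a set `I` of columns, of weight `Σ_{i ∈ I} w (ρ i, i)`.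

Helper mode (`--supports stmt-ValiantsHypothesis-16133 --as helper`); no definitions.  Honest framing: bookkeeping for
a dormant rung line of the OPEN crux `OrbitDimensionBound`; `FreeSubtorus` and VP ≠ VNP are OPEN and not moved here.

References: [LandsbergRessayre2017] Landsberg–Ressayre, Differential Geom. Appl. 55 (2017), §3.3, §6;
[Vonzurgathen1987] von zur Gathen, Linear Algebra Appl. 96 (1987), Thm. 3.1.
-/

set_option linter.dupNamespace false

namespace Summit.ValiantsHypothesis.ValiantsHypothesis.Theorems.FreeSubtorusOrbitDimensionBound.SignCovering

open Matrix MvPolynomial Finset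
open Literature.Computability.AlgebraicComplexity LRPencil
open Summit.ValiantsHypothesis.ValiantsHypothesis.Theorems.RigidityForcesSymmetryRankRigidMinimalRepr
  (PathExpansion.isHomogeneous_pow_apply)

noncomputable section

/-! ### §1 Weighted potentials along `bᵀ Dᵏ` -/

section Weighted

variable {R : Type*} [CommRing R] {σ : Type*} {G : Type*} [AddCommGroup G]

/-- The negative of a weighted-homogeneous polynomial is weighted-homogeneous of the same weight. [folklore] -/
theorem isWeightedHomogeneous_neg {w : σ → G} {φ : MvPolynomial σ R} {g : G}
    (h : φ.IsWeightedHomogeneous w g) : (-φ).IsWeightedHomogeneous w g :=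
  (weightedHomogeneousSubmodule R w g).neg_mem h

/-- **Potentials along an ABP.**  If `b_j` is weighted-homogeneous of weight `θ − a_j` and `D_{jl}` of weight
`a_j − a_l`, then `(bᵀ Dᵏ)_l` is weighted-homogeneous of weight `θ − a_l` (the weight of a path telescopes).
[folklore] -/
theorem isWeightedHomogeneous_vecMul_pow {ι : Type*} [Fintype ι] [DecidableEq ι] (w : σ → G)
    (b : ι → MvPolynomial σ R) (D : Matrix ι ι (MvPolynomial σ R)) (θ : G) (a : ι → G)
    (hb : ∀ j, (b j).IsWeightedHomogeneous w (θ - a j))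
    (hD : ∀ j l, (D j l).IsWeightedHomogeneous w (a j - a l)) :
    ∀ (k : ℕ) (l : ι), ((b ᵥ* (D ^ k)) l).IsWeightedHomogeneous w (θ - a l) := by
  intro k
  induction k with
  | zero => intro l; rw [pow_zero, Matrix.vecMul_one]; exact hb l
  | succ k ih =>
    intro l
    rw [pow_succ, ← Matrix.vecMul_vecMul, Matrix.vecMul, dotProduct]
    refine IsWeightedHomogeneous.sum _ _ _ fun j _ => ?_
    have := (ih j).mul (hD j l)
    rwa [sub_add_sub_cancel] at this

/-- The linear part of a polynomial is `Σ_p coeff_{e_p} · X_p` (finitely many variables). [folklore] -/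
theorem homogeneousComponent_one_eq_sum [Fintype σ] (q : MvPolynomial σ R) :
    homogeneousComponent 1 q = ∑ p, C (coeff (Finsupp.single p 1) q) * X p := by
  classical
  have hdeg : (homogeneousComponent 1 q).totalDegree ≤ 1 := (homogeneousComponent_isHomogeneous 1 q).totalDegree_le
  have h := LRPencil.eq_affine_of_totalDegree_le_one _ hdeg
  have h0 : coeff 0 (homogeneousComponent 1 q) = 0 := by
    rw [coeff_homogeneousComponent, if_neg]
    simp
  rw [h0, C_0, zero_add] at h
  rw [h]
  refine Finset.sum_congr rfl fun p _ => ?_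
  rw [coeff_homogeneousComponent, if_pos]
  simp

/-- If every variable `X_p` occurring LINEARLY in `q` (i.e. with `coeff_{e_p} q ≠ 0`) has weight `g`, then the
linear part of `q` is weighted-homogeneous of weight `g`. [folklore] -/
theorem isWeightedHomogeneous_homogeneousComponent_one [Fintype σ] (w : σ → G)
    (q : MvPolynomial σ R) (g : G) (h : ∀ p, coeff (Finsupp.single p 1) q ≠ 0 → w p = g) :
    (homogeneousComponent 1 q).IsWeightedHomogeneous w g := by
  rw [homogeneousComponent_one_eq_sum]
  refine IsWeightedHomogeneous.sum _ _ _ fun p _ => ?_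
  by_cases hp : coeff (Finsupp.single p 1) q = 0
  · rw [hp, C_0, zero_mul]; exact isWeightedHomogeneous_zero R w g
  · rw [← h p hp]; exact (isWeightedHomogeneous_X R w p).C_mul _

/-- `(bᵀ Dᵏ)_l` is a form of degree `k + 1` for linear `b, D` (tree: `PathExpansion.isHomogeneous_pow_apply`).
[folklore] -/
theorem isHomogeneous_vecMul_pow {F : Type*} [Field F] {ι : Type*} [Fintype ι] [DecidableEq ι]
    {b : ι → MvPolynomial σ F} {D : Matrix ι ι (MvPolynomial σ F)}
    (hb : ∀ j, (b j).IsHomogeneous 1) (hD : ∀ i j, (D i j).IsHomogeneous 1) (k : ℕ) (l : ι) :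
    ((b ᵥ* (D ^ k)) l).IsHomogeneous (k + 1) := by
  simp only [Matrix.vecMul, dotProduct]
  refine IsHomogeneous.sum _ _ _ fun j _ => ?_
  have := (hb j).mul (PathExpansion.isHomogeneous_pow_apply hD k j l)
  rwa [add_comm] at this

end Weighted

/-! ### §2 Regularity with a constant factor -/
section Regular

/-- von zur Gathen regularity with a constant factor: an affine `B` of size `m` with `det B = c · per_n`, `c ≠ 0`,
`n ≥ 3`, has `rank B(0) = m − 1` (rescale one row by `c⁻¹` and apply `isRegularDetRepr_perPoly`), and `m ≥ 1`.
[cite: Vonzurgathen1987, Thm. 3.1] -/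
theorem rank_constPart_of_det_eq_C_mul_perPoly {n m : ℕ} (hn : 3 ≤ n)
    (B : Matrix (Fin m) (Fin m) (MvPolynomial (Fin n × Fin n) ℂ)) (c : ℂ) (hc : c ≠ 0)
    (hdeg : ∀ i j, (B i j).totalDegree ≤ 1) (hdet : B.det = C c * perPoly (Fin n) ℂ) :
    1 ≤ m ∧ (constPart B).rank = m - 1 := by
  classical
  have hm : 1 ≤ m := by
    rcases Nat.eq_zero_or_pos m with rfl | h
    · exfalso
      have h1 : constantCoeff B.det = 1 := by rw [Matrix.det_isEmpty, map_one]
      rw [hdet, map_mul, constantCoeff_C, constantCoeff_perPoly ℂ (by omega : 1 ≤ n), mul_zero] at h1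
      exact zero_ne_one h1
    · exact h
  refine ⟨hm, ?_⟩
  set i₁ : Fin m := ⟨0, hm⟩ with hi₁
  set d : Fin m → ℂ := fun i => if i = i₁ then c⁻¹ else 1 with hd
  set B₁ : Matrix (Fin m) (Fin m) (MvPolynomial (Fin n × Fin n) ℂ) := (Matrix.diagonal d).map C * B with hB₁
  have hB₁ap : ∀ i j, B₁ i j = C (d i) * B i j := by
    intro i j
    simp only [hB₁, Matrix.mul_apply, Matrix.map_apply, Matrix.diagonal_apply]
    rw [Finset.sum_eq_single i]
    · simp
    · intro k _ hk; simp [Ne.symm hk]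
    · simp
  have hdetd : (Matrix.diagonal d).det = c⁻¹ := by
    rw [Matrix.det_diagonal, Finset.prod_eq_single i₁]
    · simp [hd]
    · intro i _ hi; simp [hd, hi]
    · simp
  have hrepr : IsAffineDetRepr (perPoly (Fin n) ℂ) B₁ := by
    refine ⟨fun i j => ?_, ?_⟩
    · rw [hB₁ap]
      refine (totalDegree_mul _ _).trans ?_
      rw [totalDegree_C, zero_add]
      exact hdeg i j
    · rw [hB₁, Matrix.det_mul, det_map_C, hdetd, hdet, ← mul_assoc, ← map_mul, inv_mul_cancel₀ hc, C_1, one_mul]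
  have hreg := (isRegularDetRepr_perPoly vonzurGathen1987_perm_detRepr_rank_holds hn hrepr).2
  have hcP : constPart B₁ = Matrix.diagonal d * constPart B := by
    rw [hB₁, constPart_mul, constPart_map_C]
  have hdu : IsUnit (Matrix.diagonal d).det := by
    rw [hdetd]; exact isUnit_iff_ne_zero.mpr (inv_ne_zero hc)
  rw [hcP, Matrix.rank_mul_eq_right_of_isUnit_det _ _ hdu] at hreg
  exact hreg

end Regular

/-! ### §3 The group-graded normal form -/
section NormalForm

/-- **Group-graded normal form.**  Let `G` be an additive commutative group embedded in `ℤ` by `enc` (only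
equality of grades matters), `B` an affine `m × m` matrix over `ℂ[x_{kl}]` with `det B = c · per_n`, `c ≠ 0`,
`n ≥ 3`, GRADED for row grades `rβ`, column grades `rα` and variable grades `ω` (constants only where
`rβ i = rα j`, the variable `x_p` only where `rβ i = rα j + ω p`).  Then some `B'` — obtained from `B` by a graded
constant gauge and row/column permutations — is affine, graded for permuted grades `rβ'`, `rα'` and the same
`ω`, has `det B' = c' · per_n` with `c' ≠ 0`, and its constant part is the Landsberg–Ressayre normal form
`Λ_{i₀}`.  (Degree-graded twin: `FreeSubtorusOrbitDimensionBound.gradedNormalForm`.)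
[cite: LandsbergRessayre2017, §3.3] -/
theorem classGraded_normalForm {G : Type*} [AddCommGroup G] (enc : G → ℤ) (henc : Function.Injective enc)
    {n m : ℕ} (hn : 3 ≤ n) (B : Matrix (Fin m) (Fin m) (MvPolynomial (Fin n × Fin n) ℂ))
    (rβ rα : Fin m → G) (ω : Fin n × Fin n → G) (c : ℂ) (hc : c ≠ 0)
    (hdeg : ∀ i j, (B i j).totalDegree ≤ 1) (hdet : B.det = C c * perPoly (Fin n) ℂ)
    (h0 : ∀ i j, constPart B i j ≠ 0 → rβ i = rα j)
    (h1 : ∀ i j p, coeffMat B p i j ≠ 0 → rβ i = rα j + ω p) :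
    ∃ (B' : Matrix (Fin m) (Fin m) (MvPolynomial (Fin n × Fin n) ℂ)) (rβ' rα' : Fin m → G) (i₀ : Fin m)
      (c' : ℂ), c' ≠ 0 ∧ (∀ i j, (B' i j).totalDegree ≤ 1) ∧ B'.det = C c' * perPoly (Fin n) ℂ ∧
      (∀ i j, constPart B' i j ≠ 0 → rβ' i = rα' j) ∧
      (∀ i j p, coeffMat B' p i j ≠ 0 → rβ' i = rα' j + ω p) ∧
      constPart B' = lamMatrix ℂ i₀ := by
  classical
  set X₀ := constPart B with hX₀
  -- graded elimination of the constant part (grades encoded in `ℤ`)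
  obtain ⟨P, Q, hP, hQ, hPg, hQg, h01, hrow, hcol⟩ :=
    FreeSubtorusOrbitDimensionBound.stub_gradedElimination (fun i => enc (rβ i)) (fun j => enc (rα j)) X₀
      (fun i j hij => congrArg enc (h0 i j hij))
  -- regularity: `rank X₀ = m - 1`, preserved by the invertible `P, Q`
  obtain ⟨hm, hreg⟩ := rank_constPart_of_det_eq_C_mul_perPoly hn B c hc hdeg hdet
  have hPdet : IsUnit P.det := (Matrix.isUnit_iff_isUnit_det P).1 hP
  have hQdet : IsUnit Q.det := (Matrix.isUnit_iff_isUnit_det Q).1 hQ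
  have hrank : (P * X₀ * Q).rank = m - 1 := by
    rw [Matrix.rank_mul_eq_left_of_isUnit_det Q _ hQdet, Matrix.rank_mul_eq_right_of_isUnit_det P _ hPdet]
    exact hreg
  obtain ⟨ρ, κ, i₀, hY⟩ :=
    FreeSubtorusOrbitDimensionBound.stub_partialPermDiag (P * X₀ * Q) h01 hrow hcol (by omega)
  -- the gauged, permuted matrix and its constant
  set B₁ : Matrix (Fin m) (Fin m) (MvPolynomial (Fin n × Fin n) ℂ) := P.map C * B * Q.map C with hB₁
  set B' : Matrix (Fin m) (Fin m) (MvPolynomial (Fin n × Fin n) ℂ) := B₁.submatrix ρ κ with hB'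
  set c' : ℂ := (Equiv.Perm.sign ρ : ℂ) * (Equiv.Perm.sign κ : ℂ) * (P.det * Q.det) * c with hc'
  have hc'0 : c' ≠ 0 := by
    have h1' : ((Equiv.Perm.sign ρ : ℤ) : ℂ) ≠ 0 := by
      rcases Int.units_eq_one_or (Equiv.Perm.sign ρ) with h | h <;> simp [h]
    have h2' : ((Equiv.Perm.sign κ : ℤ) : ℂ) ≠ 0 := by
      rcases Int.units_eq_one_or (Equiv.Perm.sign κ) with h | h <;> simp [h]
    exact mul_ne_zero (mul_ne_zero (mul_ne_zero h1' h2') (mul_ne_zero hPdet.ne_zero hQdet.ne_zero)) hc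
  have hdetB' : B'.det = C c' * perPoly (Fin n) ℂ := by
    have e1 : B' = (B₁.submatrix id κ).submatrix ρ id := by
      ext i j; simp [hB', Matrix.submatrix_apply]
    rw [e1, Matrix.det_permute, Matrix.det_permute', hB₁, det_map_C_mul_mul_map_C, hdet, hc']
    simp only [map_mul]
    have hs : ∀ τ : Equiv.Perm (Fin m), ((Equiv.Perm.sign τ : ℤ) : MvPolynomial (Fin n × Fin n) ℂ) =
        C ((Equiv.Perm.sign τ : ℤ) : ℂ) := fun τ => by simp
    rw [hs ρ, hs κ]; ring
  -- constants of `B'` come from constants of `B` through graded `P`, `Q`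
  have hconst : ∀ i j, constPart B' i j = (P * X₀ * Q) (ρ i) (κ j) := by
    intro i j
    rw [constPart_apply, hB', Matrix.submatrix_apply, ← constPart_apply, hB₁, constPart_mul, constPart_map_C,
      constPart_mul, constPart_map_C]
  refine ⟨B', fun i => rβ (ρ i), fun j => rα (κ j), i₀, c', hc'0, ?_, hdetB', ?_, ?_, ?_⟩
  · -- affine entries
    intro i j
    rw [hB', Matrix.submatrix_apply, hB₁]
    exact totalDegree_map_C_mul_mul_map_C_le P Q hdeg _ _
  · -- constants are graded
    intro i j hij
    rw [hconst, Matrix.mul_apply] at hij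
    obtain ⟨j', _, hj'⟩ := Finset.exists_ne_zero_of_sum_ne_zero hij
    have hQ' : Q j' (κ j) ≠ 0 := right_ne_zero_of_mul hj'
    have hPX : (P * X₀) (ρ i) j' ≠ 0 := left_ne_zero_of_mul hj'
    rw [Matrix.mul_apply] at hPX
    obtain ⟨i', _, hi'⟩ := Finset.exists_ne_zero_of_sum_ne_zero hPX
    have h := h0 i' j' (right_ne_zero_of_mul hi')
    have hp : rβ (ρ i) = rβ i' := henc (hPg _ _ (left_ne_zero_of_mul hi'))
    have hq : rα j' = rα (κ j) := henc (hQg _ _ hQ')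
    show rβ (ρ i) = rα (κ j)
    rw [hp, h, hq]
  · -- variables are graded
    intro i j v hij
    rw [coeffMat_apply, hB', Matrix.submatrix_apply, ← coeffMat_apply, hB₁, coeffMat_C_mul_mul_C,
      Matrix.mul_apply] at hij
    obtain ⟨j', _, hj'⟩ := Finset.exists_ne_zero_of_sum_ne_zero hij
    have hQ' : Q j' (κ j) ≠ 0 := right_ne_zero_of_mul hj'
    have hPX : (P * coeffMat B v) (ρ i) j' ≠ 0 := left_ne_zero_of_mul hj'
    rw [Matrix.mul_apply] at hPX
    obtain ⟨i', _, hi'⟩ := Finset.exists_ne_zero_of_sum_ne_zero hPX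
    have h := h1 i' j' v (right_ne_zero_of_mul hi')
    have hp : rβ (ρ i) = rβ i' := henc (hPg _ _ (left_ne_zero_of_mul hi'))
    have hq : rα j' = rα (κ j) := henc (hQg _ _ hQ')
    show rβ (ρ i) = rα (κ j) + ω v
    rw [hp, h, hq]
  · -- the constant part is `Λ_{i₀}`
    ext i j
    rw [hconst, hY i j, lamMatrix_apply]
    by_cases hij : i = j
    · subst hij
      by_cases hi : i = i₀
      · simp [hi]
      · simp [hi]
    · simp [hij]

end NormalForm

/-! ### §4 The `𝔽₂` side: double annihilator and coset counts -/

section F2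

variable {X : Type*} [Fintype X]

/-- **Double annihilator over `𝔽₂`** (one inclusion): a vector `w` orthogonal (for the dot product) to every `s`
that is orthogonal to all `L i` lies in the span of the `L i`. [folklore] -/
theorem mem_span_of_forall_dotProduct_eq_zero {r : ℕ} (L : Fin r → X → ZMod 2) (w : X → ZMod 2)
    (hw : ∀ s : X → ZMod 2, (∀ i, ∑ x, L i x * s x = 0) → ∑ x, w x * s x = 0) :
    w ∈ Submodule.span (ZMod 2) (Set.range L) := by
  classical
  by_contra hnot
  obtain ⟨f, hf, hfU⟩ := Submodule.exists_dual_map_eq_bot_of_notMem hnot inferInstance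
  -- the functional `f` is the dot product with `s x = f (e_x)`
  have key : ∀ v : X → ZMod 2, f v = ∑ x, v x * f (Pi.single x 1) := by
    intro v
    conv_lhs => rw [← Finset.univ_sum_single v]
    rw [map_sum]
    refine Finset.sum_congr rfl fun x _ => ?_
    have : (Pi.single x (v x) : X → ZMod 2) = v x • (Pi.single x 1 : X → ZMod 2) := by
      ext y; by_cases h : y = x <;> simp [h]
    rw [this, map_smul, smul_eq_mul]
  have hL : ∀ i, ∑ x, L i x * f (Pi.single x 1) = 0 := by
    intro i
    rw [← key]
    have hmem : L i ∈ Submodule.span (ZMod 2) (Set.range L) := Submodule.subset_span ⟨i, rfl⟩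
    have h2 : f (L i) ∈ Submodule.map f (Submodule.span (ZMod 2) (Set.range L)) := Submodule.mem_map_of_mem hmem
    rw [hfU, Submodule.mem_bot] at h2
    exact h2
  exact hf ((key w).trans (hw _ hL))

/-- Vectors injectively labelled by a finset `T` and lying in ONE coset of a subspace `U ≤ 𝔽₂^X` number at most
`|U|`. [folklore] -/
theorem card_le_natCard_of_mkQ_eq (U : Submodule (ZMod 2) (X → ZMod 2)) {ι : Type*} (T : Finset ι)
    (v : ι → X → ZMod 2) (hv : Set.InjOn v T) (g : (X → ZMod 2) ⧸ U) (hT : ∀ i ∈ T, U.mkQ (v i) = g) :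
    T.card ≤ Nat.card U := by
  classical
  haveI : Fintype U := Fintype.ofFinite U
  rw [Nat.card_eq_fintype_card, ← Finset.card_univ]
  by_cases hne : T.Nonempty
  · obtain ⟨i₀, hi₀⟩ := hne
    have hmem : ∀ i ∈ T, v i - v i₀ ∈ U := by
      intro i hi
      rw [← Submodule.Quotient.eq, ← Submodule.mkQ_apply, ← Submodule.mkQ_apply, hT i hi, hT i₀ hi₀]
    refine Finset.card_le_card_of_injOn (fun i => if h : v i - v i₀ ∈ U then (⟨v i - v i₀, h⟩ : U) else 0)
      (fun _ _ => Finset.mem_coe.2 (Finset.mem_univ _)) ?_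
    intro i hi i' hi' h
    have hi1 := hmem i hi
    have hi'1 := hmem i' hi'
    simp only [dif_pos hi1, dif_pos hi'1, Subtype.mk.injEq, sub_left_inj] at h
    exact hv hi hi' h
  · rw [Finset.not_nonempty_iff_eq_empty.1 hne, Finset.card_empty]
    exact Nat.zero_le _

/-- A subspace of `𝔽₂^X` spanned by `r` vectors has at most `2^r` elements. [folklore] -/
theorem natCard_span_le_two_pow {r : ℕ} (L : Fin r → X → ZMod 2) :
    Nat.card (Submodule.span (ZMod 2) (Set.range L)) ≤ 2 ^ r := by
  rw [Module.natCard_eq_pow_finrank (K := ZMod 2), Nat.card_zmod]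
  refine Nat.pow_le_pow_right (by norm_num) ?_
  have h := finrank_range_le_card (R := ZMod 2) L
  rw [Fintype.card_fin] at h
  exact h

end F2

/-! ### §5 Sub-monomials of a permutation monomial -/

section PermMonomial

variable {n : Type*}

/-- An exponent vector below the permutation monomial `μ_ρ = Σ_i e_{(ρ i, i)}` is `Σ_{i ∈ I} e_{(ρ i, i)}` for the set
`I` of columns it meets. [folklore] -/
theorem exists_eq_sum_single_of_le_permMonomial [Fintype n] [DecidableEq n] (ρ : Equiv.Perm n) (d : (n × n) →₀ ℕ)
    (hd : d ≤ permMonomial ρ) :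
    ∃ I : Finset n, d = ∑ i ∈ I, Finsupp.single (ρ i, i) 1 := by
  classical
  refine ⟨univ.filter fun i => d (ρ i, i) ≠ 0, ?_⟩
  ext ⟨r, c⟩
  have hle : d (r, c) ≤ if ρ c = r then 1 else 0 := by
    have := hd (r, c); rwa [permMonomial_apply] at this
  rw [Finsupp.coe_finsetSum, Finset.sum_apply]
  simp only [Finsupp.single_apply, Prod.mk.injEq]
  by_cases hcI : c ∈ univ.filter fun i => d (ρ i, i) ≠ 0
  · have hc0 : d (ρ c, c) ≠ 0 := (mem_filter.1 hcI).2
    rw [Finset.sum_eq_single_of_mem c hcI (fun i _ hic => if_neg (fun h => hic h.2))]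
    by_cases hcr : ρ c = r
    · subst hcr
      rw [if_pos ⟨rfl, rfl⟩]
      rw [if_pos rfl] at hle
      omega
    · rw [if_neg (fun h => hcr h.1)]
      rw [if_neg hcr] at hle
      omega
  · have hzero : ∀ i ∈ univ.filter (fun i => d (ρ i, i) ≠ 0), (if ρ i = r ∧ i = c then (1 : ℕ) else 0) = 0 := by
      intro i hi
      refine if_neg fun h => ?_
      obtain ⟨-, rfl⟩ := h
      exact hcI hi
    rw [Finset.sum_eq_zero hzero]
    simp only [mem_filter, mem_univ, true_and, not_not] at hcI
    by_cases hcr : ρ c = r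
    · subst hcr; exact hcI
    · rw [if_neg hcr] at hle; omega

/-- The weight of `Σ_{i ∈ I} e_{(ρ i, i)}` for any additive weight `w` is `Σ_{i ∈ I} w (ρ i, i)`. [folklore] -/
theorem weight_sum_single {M : Type*} [AddCommMonoid M] (w : n × n → M) (ρ : Equiv.Perm n) (I : Finset n) :
    Finsupp.weight w (∑ i ∈ I, Finsupp.single (ρ i, i) 1) = ∑ i ∈ I, w (ρ i, i) := by
  rw [map_sum]
  exact Finset.sum_congr rfl fun i _ => by rw [Finsupp.weight_single, one_smul]

end PermMonomial


end

end Summit.ValiantsHypothesis.ValiantsHypothesis.Theorems.FreeSubtorusOrbitDimensionBound.SignCovering
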